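import Summits.ResolutionOfSingularities.ResolutionOfSingularities.Theorems.EquisingularLiftEquisingularLiftNatClusterFrameAdapted
import Summits.ResolutionOfSingularities.ResolutionOfSingularities.Theorems.EquisingularLiftEquisingularLiftNatFrameChangeClauses
import HarnessLib

/-!
# [OURS · L1 W4.5(b) · EL♮(3)] (δ) D4 — THE PER-POINT TUPLE: B4a★'s output at a point of a cluster, for the adapted frame `c'` and
# the substituted cluster cone `Φ' = Φ_S ∘ θ` (pointed chart clauses)
# (crux `EquisingularLiftNatThree` stmt-ResolutionOfSingularities-20148 / parent 20038; rung v7′ TC⁺⁺, STEP 0 per subset)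

NOT a statement of any manuscript. Helper file of the chain res-L1-w45b (cell `res-hironaka`, LADDER-RESOLUTION rung L, slot W4.5(b));
OURS; AI-written, weaker than expert review; `--supports stmt-ResolutionOfSingularities-20148 --as helper` by res-L1-w45b-stub-3 (brick D4 of
`L/res-L1-w45b-stub-3/DELTA-PLAN.md`; res-L1-w45b-plan-1 BOOKING 2026-08-27T16:20:41Z). No `sorry`; standard axioms; no definitions.

WHAT. res-type-100's B8 `tcPlus_member_centred` (p547231) builds the `TCPlus.Member` at ONE point from the tuple of B4a★
`exists_centredConeLift_three_exact` (p546008): an adapted section frame `c` with its slots, the presentation of the point as `[1:0:0]`,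
and a centred cone `Φ` with `hcen / hexact / hΦu, hregu / hΦv, hregv`. For a SUBSET `S` of a cluster the cone is ONE form `Φ_S` for all
points ((δ) D1 `exists_clusterConeLift_subset`, p548257), read at the point `t` through the frame change of (δ) D2. **`exists_clusterConeLift_at`**
assembles, from the section frame `c`, the point's chart `i` and lifted coordinates `ã`, res-type-100's (δ) D3a presentation of the point
(translated clause), and D1's clauses AT `t`, the B4a★-shaped tuple for the adapted frame `c'` (hypotheses `hc'0 / hc's`) and the
substituted cone `Φ'`: all frame slots (…NatClusterFrameAdapted `exists_clusterFrame_adapted_at`), `Φ'` homogeneous of degree `d`,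
`hcen`, `hexact`, the three non-vanishing slots, **`Φ'(c') = Φ_S(c)`** (one cone divisor `K₀` serves every point of `S`), and the chart
clauses `hΦu / hΦv` with the POINTED `hregu / hregv` of `tcPlus_centredPackage_of_axisSection_over` (…NatCentredPackageFrameOver p550804).
What B4a★ has and this tuple has not: the off-vertex `ρ`-form Δ-clause (in (δ) it is D1's standard-chart clause, consumed per subset with
res-type-100's D3d) and the exact-special-fibre clause `hfib` (frame-free; transfers by `Φ'(c') = Φ_S(c)`).

References: res-L1-w45b-stub-3 p548257 (D1), p551302 + …NatFrameChangeClauses (D2), …NatClusterFrameAdapted; res-type-100 p546008 (B4a★),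
p547231 (B8), p551356 (D3a). H. Matsumura, *Commutative Ring Theory* (1986), Thm. 14.2 [cite: Matsumura1987]; The Stacks Project, Tag 0804
[cite: StacksProject, Tag 0804].
-/

set_option linter.dupNamespace false -- mandated namespace `Summit.<Summit>.<Problem>` of this single-conjunct summit
set_option linter.overlappingInstances false -- signatures carry `[IsDomain O] [IsDiscreteValuationRing O]`

noncomputable section

open CategoryTheory CategoryTheory.Limits AlgebraicGeometry TopologicalSpace IsLocalRing MvPolynomial
open Literature.AlgebraicGeometry.Resolution
open AlgebraicGeometry.Scheme.IdealSheafData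
open Summit.ResolutionOfSingularities.ResolutionOfSingularities.Cruxes.EquisingularLiftNat.Sections

namespace Summit.ResolutionOfSingularities.ResolutionOfSingularities.Cruxes.EquisingularLiftNat.Sections.TCPlus

/-- A polynomial with a unit coefficient does not vanish after a change of coefficients into a nontrivial ring. [folklore] -/
theorem map_ne_zero_of_isUnit_coeff {R S : Type*} [CommRing R] [CommRing S] [Nontrivial S] (f : R →+* S) {σ : Type*}
    {Φ : MvPolynomial σ R} {α : σ →₀ ℕ} (hα : IsUnit (Φ.coeff α)) : MvPolynomial.map f Φ ≠ 0 := by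
  intro h
  have h1 : (MvPolynomial.map f Φ).coeff α = 0 := by rw [h, MvPolynomial.coeff_zero]
  rw [MvPolynomial.coeff_map] at h1
  exact (hα.map f).ne_zero h1

set_option maxHeartbeats 800000 in -- chart algebra of a stalk = subalgebra of a localisation: slow instance unification (as p527425)
/-- **(δ) D4 — the B4a★-shaped tuple at a point of a cluster.** See the module docstring: frame slots of the adapted frame `c'`
(`exists_clusterFrame_adapted_at`), and for `Φ' = Φ_S ∘ θ` (θ the frame substitution of (δ) D2): homogeneous of degree `d`, `hcen`,
`hexact`, `Φ' mod 𝔪_O ≠ 0`, `ι_*Φ' mod (c') ≠ 0` upstairs and downstairs, `Φ'(c') = Φ_S(c)`, and the chart clauses with POINTED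
regularity. [cite: Matsumura1987, Thm. 14.2] [OURS · L1 W4.5b] (δ) D4; NOT a statement of the manuscript. -/
theorem exists_clusterConeLift_at (O : Type) [CommRing O] [IsDomain O] [IsDiscreteValuationRing O]
    {X' F₁ F₂ : Scheme.{0}} (r' : X' ⟶ Spec (.of O)) [IsSeparated r']
    (s : Spec (.of O) ⟶ X') (hs : s ≫ r' = 𝟙 _) (j : F₁ ⟶ X') (x : F₁)
    (hss : s (IsLocalRing.closedPoint O) = j x) (hreg : IsRegularLocalRing (X'.presheaf.stalk (j x)))
    (hdim : ringKrullDim (X'.presheaf.stalk (j x)) = ((3 + 1 : ℕ) : WithBot ℕ∞)) (ϖ : O) (hϖ : Irreducible ϖ)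
    (υ : F₂ ⟶ F₁) (q' : F₂) (hq' : υ q' = x)
    -- the section frame and its D2-adaptation to the chart `i` and the lifted coordinates `ã`
    (c : Fin 3 → X'.presheaf.stalk (j x)) (hcI : Ideal.span (Set.range c) = stalkIdeal s.ker (j x))
    (i : Fin 3) (a : {l : Fin 3 // l ≠ i} → O) (c' : Fin 3 → X'.presheaf.stalk (j x)) (hc'0 : c' 0 = c i)
    (hc's : ∀ l : Fin 2, c' l.succ = c (i.succAbove l) -
      ((Scheme.ΓSpecIso (.of O)).inv ≫ r'.appTop ≫ X'.presheaf.Γgerm (j x)).hom (a ⟨i.succAbove l, Fin.succAbove_ne i l⟩) * c i)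
    -- (δ) D3a: the presentation of `q′` on chart `i` of `c̄`, translated by `ã`
    (Hp : ∃ (𝔮 : PrimeSpectrum (blowupAlgebra (Ideal.span (Set.range fun l => (j.stalkMap x).hom (c l)))
        ((j.stalkMap x).hom (c i))))
      (χ : blowupAlgebra (Ideal.span (Set.range fun l => (j.stalkMap x).hom (c l))) ((j.stalkMap x).hom (c i)) →+*
        F₂.presheaf.stalk q')
      (e : F₂.presheaf.stalk q' ≃+* Localization.AtPrime 𝔮.asIdeal),
      (∀ r, χ (algebraMap _ _ r) = ((F₁.presheaf.stalkCongr (Inseparable.of_eq hq')).inv ≫ υ.stalkMap q').hom r) ∧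
      @IsLocalization.AtPrime _ _ (F₂.presheaf.stalk q') _ χ.toAlgebra 𝔮.asIdeal _ ∧
      (∀ b, e (χ b) = algebraMap _ (Localization.AtPrime 𝔮.asIdeal) b) ∧
      𝔮.asIdeal.comap (algebraMap _ (blowupAlgebra (Ideal.span (Set.range fun l => (j.stalkMap x).hom (c l)))
        ((j.stalkMap x).hom (c i)))) = maximalIdeal (F₁.presheaf.stalk x) ∧
      ∀ l : {l : Fin 3 // l ≠ i}, blowupAlgebra.frac (fun l => (j.stalkMap x).hom (c l)) i l.1 -
        algebraMap _ _ ((j.stalkMap x).hom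
          (((Scheme.ΓSpecIso (.of O)).inv ≫ r'.appTop ≫ X'.presheaf.Γgerm (j x)).hom (a l))) ∈ 𝔮.asIdeal)
    -- (δ) D1: the cluster cone and its clauses AT the point
    {d m : ℕ} (Φ : MvPolynomial (Fin 3) O) (hΦd : Φ.IsHomogeneous d)
    (hcen : dehomogenize i Φ ∈ (Ideal.span (Set.range fun l => (X l : MvPolynomial {l : Fin 3 // l ≠ i} O) - C (a l))) ^ m)
    (hexact : ∃ α : {l : Fin 3 // l ≠ i} →₀ ℕ, α.degree = m ∧
      IsUnit (coeff α (aeval (fun l => (X l : MvPolynomial {l : Fin 3 // l ≠ i} O) + C (a l)) (dehomogenize i Φ))))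
    (hst : ∀ p : {l : Fin 3 // l ≠ i}, ∃ Φst : MvPolynomial {l : Fin 3 // l ≠ i} O,
      (X p : MvPolynomial {l : Fin 3 // l ≠ i} O) ^ m * Φst =
        aeval (fun l => if l = p then (X p : MvPolynomial {l : Fin 3 // l ≠ i} O) else X p * X l)
          (aeval (fun l => (X l : MvPolynomial {l : Fin 3 // l ≠ i} O) + C (a l)) (dehomogenize i Φ)) ∧
      ∀ (Q : Ideal (MvPolynomial {l : Fin 3 // l ≠ i} O ⧸ Ideal.span {Φst})) [Q.IsPrime],
        Ideal.Quotient.mk (Ideal.span {Φst}) (C ϖ : MvPolynomial {l : Fin 3 // l ≠ i} O) ∈ Q →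
        Ideal.Quotient.mk (Ideal.span {Φst}) (X p : MvPolynomial {l : Fin 3 // l ≠ i} O) ∈ Q →
        IsRegularLocalRing (Localization.AtPrime Q)) :
    ∃ (θR : (X'.presheaf.stalk (j x) ⧸ Ideal.span (Set.range c')) ≃+* O) (Φ' : MvPolynomial (Fin 3) O)
      (Φu Φv : MvPolynomial (Fin 2) O),
      -- the adapted section frame at `j x`
      Ideal.span (Set.range c') = stalkIdeal s.ker (j x) ∧ IsQuasiRegular c' ∧
      IsDomain (X'.presheaf.stalk (j x) ⧸ Ideal.span (Set.range c')) ∧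
      (∀ b : O, θR (Ideal.Quotient.mk _ ((X'.presheaf.Γgerm (j x)).hom
        (r'.appTop.hom ((Scheme.ΓSpecIso (.of O)).inv.hom b)))) = b) ∧
      Ideal.span (Set.range c') ⊔ Ideal.span {(X'.presheaf.Γgerm (j x)).hom
        (r'.appTop.hom ((Scheme.ΓSpecIso (.of O)).inv.hom ϖ))} = maximalIdeal (X'.presheaf.stalk (j x)) ∧
      (X'.presheaf.Γgerm (j x)).hom (r'.appTop.hom ((Scheme.ΓSpecIso (.of O)).inv.hom ϖ)) ∉ Ideal.span (Set.range c') ∧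
      -- the presentation of `𝒪_{F₂,q′}` on chart `0` of `c̄'`: `q′ = [1:0:0]` (T-FRAME-AT verbatim)
      (∃ (𝔔 : PrimeSpectrum (blowupAlgebra (Ideal.span (Set.range fun l => (j.stalkMap x).hom (c' l)))
          ((j.stalkMap x).hom (c' 0))))
        (χ : blowupAlgebra (Ideal.span (Set.range fun l => (j.stalkMap x).hom (c' l))) ((j.stalkMap x).hom (c' 0)) →+*
          F₂.presheaf.stalk q')
        (e : F₂.presheaf.stalk q' ≃+* Localization.AtPrime 𝔔.asIdeal),
        (∀ r, χ (algebraMap _ _ r) =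
          ((F₁.presheaf.stalkCongr (Inseparable.of_eq hq')).inv ≫ υ.stalkMap q').hom r) ∧
        @IsLocalization.AtPrime _ _ (F₂.presheaf.stalk q') _ χ.toAlgebra 𝔔.asIdeal _ ∧
        (∀ b, e (χ b) = algebraMap _ (Localization.AtPrime 𝔔.asIdeal) b) ∧
        𝔔.asIdeal.comap (algebraMap _ (blowupAlgebra (Ideal.span (Set.range fun l => (j.stalkMap x).hom (c' l)))
          ((j.stalkMap x).hom (c' 0)))) = maximalIdeal (F₁.presheaf.stalk x) ∧
        ∀ (l : {l : Fin 3 // l ≠ 0}) (y : blowupAlgebra (Ideal.span (Set.range fun l => (j.stalkMap x).hom (c' l)))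
            ((j.stalkMap x).hom (c' 0))),
          (y : Localization.Away ((j.stalkMap x).hom (c' 0))) =
            algebraMap _ (Localization.Away ((j.stalkMap x).hom (c' 0))) ((j.stalkMap x).hom (c' l.1)) *
              IsLocalization.Away.invSelf ((j.stalkMap x).hom (c' 0)) → y ∈ 𝔔.asIdeal) ∧
      -- the substituted cluster cone
      Φ'.IsHomogeneous d ∧ (∀ α ∈ Φ'.support, m ≤ α 1 + α 2) ∧
      (∃ α ∈ Φ'.support, α 1 + α 2 = m ∧ Φ'.coeff α ∉ IsLocalRing.maximalIdeal O) ∧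
      MvPolynomial.map (IsLocalRing.residue O) Φ' ≠ 0 ∧
      MvPolynomial.map (Ideal.Quotient.mk (Ideal.span (Set.range c')))
        (MvPolynomial.map ((Scheme.ΓSpecIso (.of O)).inv ≫ r'.appTop ≫ X'.presheaf.Γgerm (j x)).hom Φ') ≠ 0 ∧
      MvPolynomial.map (Ideal.Quotient.mk (Ideal.span (Set.range fun l => (j.stalkMap x).hom (c' l))))
        (MvPolynomial.map (j.stalkMap x).hom
          (MvPolynomial.map ((Scheme.ΓSpecIso (.of O)).inv ≫ r'.appTop ≫ X'.presheaf.Γgerm (j x)).hom Φ')) ≠ 0 ∧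
      -- ONE cone germ for every point of `S`: `Φ'(c') = Φ_S(c)`
      MvPolynomial.eval c' (MvPolynomial.map ((Scheme.ΓSpecIso (.of O)).inv ≫ r'.appTop ≫ X'.presheaf.Γgerm (j x)).hom Φ') =
        MvPolynomial.eval c (MvPolynomial.map ((Scheme.ΓSpecIso (.of O)).inv ≫ r'.appTop ≫ X'.presheaf.Γgerm (j x)).hom Φ) ∧
      -- the strict transforms on the two charts of the blow-up of `[1:0:0]`, Δ-regular at the primes OVER THE POINT
      MvPolynomial.aeval (![1, MvPolynomial.X 0, MvPolynomial.X 0 * MvPolynomial.X 1] : Fin 3 → MvPolynomial (Fin 2) O) Φ' =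
        MvPolynomial.X 0 ^ m * Φu ∧
      MvPolynomial.aeval (![1, MvPolynomial.X 0 * MvPolynomial.X 1, MvPolynomial.X 1] : Fin 3 → MvPolynomial (Fin 2) O) Φ' =
        MvPolynomial.X 1 ^ m * Φv ∧
      (∀ (Q : Ideal (MvPolynomial (Fin 2) O ⧸ Ideal.span {Φu})) [Q.IsPrime],
        Ideal.Quotient.mk (Ideal.span {Φu}) (MvPolynomial.C ϖ : MvPolynomial (Fin 2) O) ∈ Q →
        Ideal.Quotient.mk (Ideal.span {Φu}) (MvPolynomial.X 0 : MvPolynomial (Fin 2) O) ∈ Q →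
        IsRegularLocalRing (Localization.AtPrime Q)) ∧
      (∀ (Q : Ideal (MvPolynomial (Fin 2) O ⧸ Ideal.span {Φv})) [Q.IsPrime],
        Ideal.Quotient.mk (Ideal.span {Φv}) (MvPolynomial.C ϖ : MvPolynomial (Fin 2) O) ∈ Q →
        Ideal.Quotient.mk (Ideal.span {Φv}) (MvPolynomial.X 1 : MvPolynomial (Fin 2) O) ∈ Q →
        IsRegularLocalRing (Localization.AtPrime Q)) := by
  classical
  -- the frame substitution and the substituted cone
  refine (exists_frameSubst i a).elim fun θ hθ => ?_
  have hθi := hθ.1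
  have hθs := hθ.2
  -- the frame half
  refine (exists_clusterFrame_adapted_at O r' s hs j x hss hreg hdim ϖ hϖ υ q' hq' c hcI i a c' hc'0 hc's Hp).elim
    fun θR hfr => ?_
  -- the chart clauses and the exact coefficient (destructured with `.elim` only: the chart algebra in the goal makes `obtain` slow)
  refine (hst ⟨i.succAbove 0, Fin.succAbove_ne i 0⟩).elim fun Φst₀ h₀ => ?_
  refine (hst ⟨i.succAbove 1, Fin.succAbove_ne i 1⟩).elim fun Φst₁ h₁ => ?_
  refine (frameSubst_chartU i a θ hθi hθs ϖ Φ m Φst₀ h₀.1 h₀.2).elim fun Φu hU => ?_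
  refine (frameSubst_chartV i a θ hθi hθs ϖ Φ m Φst₁ h₁.1 h₁.2).elim fun Φv hV => ?_
  refine (frameSubst_exact i a θ hθi hθs hΦd hexact).elim fun α hαh => ?_
  have hα := hαh.1
  have hαm := hαh.2.1
  have hu := hαh.2.2
  haveI : IsDomain (X'.presheaf.stalk (j x) ⧸ Ideal.span (Set.range c')) := hfr.2.2.1
  -- the downstairs quotient is nontrivial: `c̄'` lies in `𝔪_x`
  haveI : Nontrivial (F₁.presheaf.stalk x ⧸ Ideal.span (Set.range fun l => (j.stalkMap x).hom (c' l))) := by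
    refine Ideal.Quotient.nontrivial_iff.mpr (ne_top_of_le_ne_top (Ideal.IsMaximal.ne_top (IsLocalRing.maximalIdeal.isMaximal _))
      (Ideal.span_le.2 (Set.range_subset_iff.2 fun l => ?_)))
    refine map_nonunit (j.stalkMap x).hom (c' l) ?_
    have hl : c' l ∈ maximalIdeal (X'.presheaf.stalk (j x)) := by
      rw [← hfr.2.2.2.2.1]
      exact Ideal.mem_sup_left (Ideal.subset_span (Set.mem_range_self l))
    exact hl
  -- the unit coefficient survives the changes of coefficients
  have hu₁ : IsUnit ((MvPolynomial.map ((Scheme.ΓSpecIso (.of O)).inv ≫ r'.appTop ≫ X'.presheaf.Γgerm (j x)).hom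
      (aeval θ Φ)).coeff α) := by
    rw [MvPolynomial.coeff_map]
    exact hu.map _
  have hu₂ : IsUnit ((MvPolynomial.map (j.stalkMap x).hom
      (MvPolynomial.map ((Scheme.ΓSpecIso (.of O)).inv ≫ r'.appTop ≫ X'.presheaf.Γgerm (j x)).hom (aeval θ Φ))).coeff α) := by
    rw [MvPolynomial.coeff_map]
    exact hu₁.map _
  refine ⟨θR, aeval θ Φ, Φu, Φv, hfr.1, hfr.2.1, hfr.2.2.1, hfr.2.2.2.1, hfr.2.2.2.2.1, hfr.2.2.2.2.2.1, hfr.2.2.2.2.2.2, ?_⟩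
  refine ⟨isHomogeneous_aeval_frameSubst i a θ hθi hθs hΦd, frameSubst_centred i a θ hθi hθs hΦd hcen,
    ⟨α, hα, hαm, fun hmem => (IsLocalRing.mem_maximalIdeal _).mp hmem hu⟩, ?_, ?_, ?_, ?_, hU.1, hV.1, hU.2, hV.2⟩
  · exact map_ne_zero_of_isUnit_coeff _ hu
  · exact map_ne_zero_of_isUnit_coeff _ hu₁
  · exact map_ne_zero_of_isUnit_coeff _ hu₂
  · exact eval_map_aeval_frameSubst i a θ hθi hθs _ c c' hc'0 hc's Φ

end Summit.ResolutionOfSingularities.ResolutionOfSingularities.Cruxes.EquisingularLiftNat.Sections.TCPlus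

end
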